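import Summits.CriticalPhenomena.PercolationContinuityZ3.Theorems.PercNearOneGluingNoHeavyLowerTailMajorityGluingQCertSymParts
import HarnessLib

/-!
# Part 3 of 18 of the orbit certificate of the cell `(12,7)` at `c = 157/100`: data and digest (lane prim-rate, constants-miner 1, gen 36; generated by cert/mksym.py)

Support file for the closed crux `NoHeavyLowerTail` (stmt-CriticalPhenomena-4575), majority-gluing line.  The symmetrised certificate of the cell `(12,7)`
(kit j286395, symcert.py) is checked IN PARTS (`…MajorityGluingQCertSymParts`): this file holds part 3 (0 multiplier terms, 2 marginal slacks,
0 rows, 0 squares; 4098 contributions) and its DIGEST `twelveSevenSymP3D` (36 orbit keys), verified by `decide +kernel` (`twelveSevenSymP3_digest`).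
The parts are glued in `…MajorityGluingQCertSymTwelveSeven`.  No sorries. [cite: VandenbergKahn2001, Thm 1.2 (p. 123)]
-/

namespace Summit.CriticalPhenomena.PercolationContinuityZ3.Theorems

namespace HubOnly
namespace QCert

/-- Row representatives of part 3: `(A, X, B, Y, n, masks of f(A,X), f(B,Y), f(A∪B,X∩Y), f(∅,X∪Y))`. -/
def twelveSevenSymP3Rows : List RowE :=
  []

/-- Square representatives of part 3: `(a, b, n, mask₁, mask₂)`. -/
def twelveSevenSymP3Sqs : List SqE :=
  []

/-- **Part 3** of the `(12,7)` orbit certificate at `157/100`. -/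
def twelveSevenSymP3 : SymCert :=
  ⟨⟨12, 7, 157, 100, 1, [], [], []⟩,
    [],
    [(0, 1, 135611584154567232), (0, 2046, 1154580396835699712)],
    [twelveSevenSymP3Rows], [twelveSevenSymP3Sqs]⟩

/-- The digest of part 3: `(orbit key, coefficient total)` in increasing key order (computed by cert/mksym.py, verified below). -/
def twelveSevenSymP3D : List (ℕ × ℤ) :=
  [((4098 : ℕ), (135611584154567232 : ℤ)), (4100, 1491727425700239552), (4104, 7458637128501197760), (4112, 22375911385503593280), 
    (4128, 44751822771007186560), (4160, 62652551879410061184), (4224, 62652551879410061184), (4352, 44751822771007186560), 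
    (4608, 22375911385503593280), (5120, 7458637128501197760), (6143, 1154580396835699712), (6144, 1491727425700239552), (8192, 135611584154567232), 
    (14336, 11545803968356997120), (16383, 1154580396835699712), (30722, 51956117857606487040), (32768, 11545803968356997120), 
    (63494, 138549647620283965440), (65538, 51956117857606487040), (129038, 242461883335496939520), (131078, 138549647620283965440), 
    (260126, 290954260002596327424), (262158, 242461883335496939520), (522302, 242461883335496939520), (524318, 290954260002596327424), 
    (1046654, 138549647620283965440), (1048638, 242461883335496939520), (2095358, 51956117857606487040), (2097278, 138549647620283965440), 
    (4192766, 11545803968356997120), (4193278, 1154580396835699712), (4194558, 51956117857606487040), (4194814, 11545803968356997120), 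
    (4195326, 1154580396835699712), (16781313, -135611584154567232), (16782335, -1154580396835699712)]

/-- **The digest of part 3 is `twelveSevenSymP3D`** (kernel evaluation of the part's 4098 contributions). -/
theorem twelveSevenSymP3_digest : twelveSevenSymP3.digest 20 = twelveSevenSymP3D := by
  decide +kernel

end QCert
end HubOnly

end Summit.CriticalPhenomena.PercolationContinuityZ3.Theorems
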